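import Summits.ResolutionOfSingularities.ResolutionOfSingularities.Theorems.HilbertSamuelEliminationSigmaMaxModificationsCorridor3WLadderIsoTailsBaseChangeDim
import Summits.ResolutionOfSingularities.ResolutionOfSingularities.Theorems.HilbertSamuelEliminationSigmaMaxModificationsCorridor3WLadderIsoTailsBaseChangeFibre
import Summits.ResolutionOfSingularities.ResolutionOfSingularities.Theorems.HilbertSamuelEliminationSigmaMaxModificationsCorridor3WLadderIsoTailsBaseChangeStructure
import Summits.ResolutionOfSingularities.ResolutionOfSingularities.Theorems.HilbertSamuelEliminationSigmaMaxModificationsCorridor3WLadderIsoTailsHSTransferAlongMap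
import Mathlib.AlgebraicGeometry.Noetherian
import HarnessLib

/-!
# [OURS · L1 W4.2] K2-sep ROUTE A, brick (δ2) ASSEMBLED: **maximal origins and isolation in the Hilbert–Samuel locus TRANSFER to the
# separable ground-field base change `X ×_k K`** — for `f : X → Spec k` separated, locally of finite type, quasi-compact, `K/k` separable
# algebraic of any degree, and `x′ ∈ X ×_k K` over `x`:
# `IsMaximalOrigin p N ν X x → IsMaximalOrigin p N ν (X ×_k K) x′` and, for `x` closed, `IsIsolatedInHSMaxLocus X N x → IsIsolatedInHSMaxLocus (X ×_k K) N x′`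
# ((δ1) `H` pointwise, (δ2) reduced / surjective / structure / fibre finite-closed / dimension, (β3) the transfer along an `H`-preserving map)
# (crux `SigmaMaxModifications` stmt-ResolutionOfSingularities-18506 / conjunct stmt-…-19249; line `w_ladder_rows` v8.5, registered stub
# `stub_isoSepRecurrent`; res-L1-w42-plan-1 WORD 2026-08-27T16:25:47Z; design `L/res-L1-w42-stub-2/k2sep/K2SEP-DESIGN.md` §8 (δ2))

Prover res-L1-w42-stub-2 (gen 5). Helper file `--supports stmt-ResolutionOfSingularities-19249 --as helper`; no definitions, no named fact. OURS
(cell res-hironaka, slot W4.2); NOT statements of [Hironaka2017] nor of [CossartJannsenSaito2020]. AI-written; AI review is weaker than expert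
review. What remains for the K2-sep reduction after this file: the `BlowupTower` base change (δ3), the step transfers (δ4) and the assembly (ε)
over `false_of_tower_of_forall_freeRational_local` (memo §8).

* `isLocallyNoetherian_pullback_SpecMap` — `X ×_k K` is locally noetherian.
* **`isMaximalOrigin_pullback_SpecMap`** — maximal origins transfer to `X ×_k K`.
* **`isIsolatedInHSMaxLocus_pullback_SpecMap`** — isolation in `X_max` at a closed point transfers to every point of `X ×_k K` above it.
* `hsMaxLocus_pullback_SpecMap_eq` — `(X ×_k K)_max = pr₁⁻¹ X_max`.

[OURS · L1 W4.2; AI-written] [cite: CossartJannsenSaito2020, Def. 2.35, Def. 13.3, Lemma 2.27 (1)] [cite: GortzWedhorn2020, Prop. 5.38]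
-/

set_option linter.dupNamespace false

noncomputable section

open scoped TensorProduct
open CategoryTheory CategoryTheory.Limits AlgebraicGeometry
open Literature.AlgebraicGeometry.Resolution Literature.AlgebraicGeometry.CossartJannsenSaito2020
open Summit.ResolutionOfSingularities.ResolutionOfSingularities.Theorems.CampaignW42

namespace Summit.ResolutionOfSingularities.ResolutionOfSingularities.Theorems.SigmaMaxModificationsCorridor3.IsoTailsHS

universe u

variable {k K : Type u} [Field k] [Field K] [Algebra k K] [Algebra.IsSeparable k K] {X : Scheme.{u}} (f : X ⟶ Spec (CommRingCat.of k))

omit [Algebra.IsSeparable k K] in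
/-- `X ×_k K` is locally noetherian (locally of finite type over the field `K`). [folklore] -/
theorem isLocallyNoetherian_pullback_SpecMap [LocallyOfFiniteType f] :
    IsLocallyNoetherian (pullback f (Spec.map (CommRingCat.ofHom (algebraMap k K)))) :=
  LocallyOfFiniteType.isLocallyNoetherian (pullback.snd f (Spec.map (CommRingCat.ofHom (algebraMap k K))))

/-- **`(X ×_k K)_max = pr₁⁻¹ X_max`** for `f` locally of finite type and `K/k` separable algebraic. [cite: CossartJannsenSaito2020, Def. 2.35] -/
theorem hsMaxLocus_pullback_SpecMap_eq [LocallyOfFiniteType f] [IsLocallyNoetherian X] (N : ℕ) :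
    Scheme.hsMaxLocus (pullback f (Spec.map (CommRingCat.ofHom (algebraMap k K)))) N =
      (pullback.fst f (Spec.map (CommRingCat.ofHom (algebraMap k K)))).base ⁻¹' Scheme.hsMaxLocus X N := by
  haveI := isLocallyNoetherian_pullback_SpecMap (K := K) f
  exact hsMaxLocus_eq_preimage_of_hsFun_eq (pullback.fst f _) N (hsFun_pullback_SpecMap_algebraMap_eq f N)
    (surjective_fst_pullback_SpecMap_field f)

/-- **ISOLATION TRANSFERS**: for `x` a CLOSED point isolated in `X_max` and `x′ ∈ X ×_k K` over `x`, `x′` is isolated in `(X ×_k K)_max`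
(`f` locally of finite type, `K/k` separable algebraic of any degree). [cite: CossartJannsenSaito2020, Def. 13.3] -/
theorem isIsolatedInHSMaxLocus_pullback_SpecMap [LocallyOfFiniteType f] [IsLocallyNoetherian X]
    [IsLocallyNoetherian (pullback f (Spec.map (CommRingCat.ofHom (algebraMap k K))))] (N : ℕ) {x : X}
    (hiso : IsIsolatedInHSMaxLocus X N x) (hxcl : IsClosed ({x} : Set X))
    {x' : ↥(pullback f (Spec.map (CommRingCat.ofHom (algebraMap k K))))}
    (hx' : (pullback.fst f (Spec.map (CommRingCat.ofHom (algebraMap k K)))).base x' = x) :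
    IsIsolatedInHSMaxLocus (pullback f (Spec.map (CommRingCat.ofHom (algebraMap k K)))) N x' :=
  isIsolatedInHSMaxLocus_of_hsFun_eq (pullback.fst f _) N (hsFun_pullback_SpecMap_algebraMap_eq f N)
    (surjective_fst_pullback_SpecMap_field f) hiso (finite_preimage_fst_pullback_SpecMap_of_isClosed f hxcl)
    (fun _ hy => isClosed_singleton_of_fst_eq_of_isClosed f hxcl hy) hx'

/-- **MAXIMAL ORIGINS TRANSFER**: for `f : X → Spec k` separated, locally of finite type and quasi-compact with `char k = p`, `K/k` separable
algebraic of any degree, a maximal origin `(X, x)` at level `N`, value `ν`, and `x′ ∈ X ×_k K` over `x`: `(X ×_k K, x′)` is a maximal origin at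
level `N`, value `ν`. [OURS · L1 W4.2] [cite: CossartJannsenSaito2020, Def. 2.35] -/
theorem isMaximalOrigin_pullback_SpecMap {p N : ℕ} {ν : ℕ → ℕ} [CharP k p] [IsSeparated f] [LocallyOfFiniteType f] [QuasiCompact f]
    [IsLocallyNoetherian X] {x : X} (hO : IsMaximalOrigin p N ν X x)
    {x' : ↥(pullback f (Spec.map (CommRingCat.ofHom (algebraMap k K))))}
    (hx' : (pullback.fst f (Spec.map (CommRingCat.ofHom (algebraMap k K)))).base x' = x) :
    IsMaximalOrigin p N ν (pullback f (Spec.map (CommRingCat.ofHom (algebraMap k K)))) x' := by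
  haveI := hO.isReduced
  exact isMaximalOrigin_of_hsFun_eq (pullback.fst f _) N (hsFun_pullback_SpecMap_algebraMap_eq f N)
    (surjective_fst_pullback_SpecMap_field f) hO (exists_structure_pullback_SpecMap (K := K) f)
    (isReduced_pullback_SpecMap_of_isSeparable f) ((topologicalKrullDim_pullback_SpecMap_le (K := K) f).trans hO.dim_le) hx'
    (isClosed_singleton_of_fst_eq_of_isClosed f hO.isClosed hx')

end Summit.ResolutionOfSingularities.ResolutionOfSingularities.Theorems.SigmaMaxModificationsCorridor3.IsoTailsHS

end
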